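/-
Copyright: lit-balaban Phase-2 proof seat p08 (gen 8).  Statement-level skeleton of a published paper; no proof claims beyond what
the kernel checks below.
-/
import Literature.MathematicalPhysics.QuantumFieldTheory.BalabanImbrieJaffe1984to88.BIJ88Decay216Native
import Literature.MathematicalPhysics.QuantumFieldTheory.BalabanImbrieJaffe1984to88.BIJ85Ineq723TorusCE
import Literature.MathematicalPhysics.QuantumFieldTheory.BalabanImbrieJaffe1984to88.BIJ88Eq220Torus

/-!
# `BalabanImbrieJaffe1984to88.BIJ88Decay223CkKernel` — T. Bałaban, J. Imbrie, A. Jaffe, *Effective action and cluster properties of the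
abelian Higgs model*, Commun. Math. Phys. **114** (1988) 257–315 [BalabanImbrieJaffe1988]: **(2.22)–(2.23)** p. 262 — THE KERNEL OF THE
`C_k` OF RECORD ON THE TORI OF THE SERIES, file 1 of 2 (entries): the kernel `C_k(x, b′) := (C_ke_{b′})(x)` of seat p08's
`BIJ88Eq220Torus.CkE P hd w c k` ((2.22) verbatim: `C_k = D_k + Σ_{j<k} D_jC^{(j)}H_j^*∂*Q^{e*}_k∂`) written through the kernels of its
factors, and two entrywise inputs of the p. 262 sentence *"The kernels of all these operators have an exponential decay on their
respective length scales; for D_k the required estimate is (I.7.2.4)"*: the `D_j`-entries `D_j(x, b₁) = λ_j(H_je_{b₁})(x)` ARE seat p08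
(gen 3)'s (I.7.2.4) kernel `BIJ85Ineq724Proof.Dk` of the Landau minimizer of record and obey its bound, and the source `∂₁e_{b′}` is an
`ℓ¹`-small local plaquette field

statement-level skeleton of published theorems with citation tags; proofs where landed; nothing here is a claim about the Yang–Mills mass gap

PDF held: `paper:balaban1988-cmp114-bij-abelian-higgs-effective-action` (journal page = PDF page + 256), p. 262 [PDF 6] (text layer
`~/.lit/texts/paper-balaban1988-cmp114-bij-abelian-higgs-effective-action/p0006.txt`, re-read this session); [I] = [BalabanImbrieJaffe1985]
(`paper:balaban1985-cmp97-bij-higgs-minimizers`), pp. 325–326 (7.2.1)–(7.2.4).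

CITATION HEADER (lean-in-tree rule).  Part of the lit-balaban TYPED SKELETON (HOME `run/shared/lean/pub/lit-balaban/`), Phase-2 proof
seat p08 (gen 8), unit `lit-balaban-p08`; WHAT IS REPRODUCED = SKELETON row **C2.Eq2.23** (reader file `HOME/lit-balaban-r18/ROWS-C2.md`,
owner r18, referee ref-5: *"proved p249538 (p08 g4; hence-step from per-scale kernel bounds, D_k slot = (I.7.2.4) hypothesis edge)"*), kind
«model instance for the operator of record»: the gen-4 hence-step is here carried out for the CONCRETE `C_k` of (2.22) on the tori (row
**C2.Eq2.22**, `BIJ88Eq220Torus.CkE`, p08 g7 p255966), joined to rows **C1.Eq7.2.4** (`BIJ85Ineq724Proof`, p08 g3), **C1.Eq7.2.1-7.2.2**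
(r15's typed `KernelData.Ineq722`, p09's torus carrier), **C2.Eq2.16** (`BIJ88Decay216Torus`, p08 g7).  TAKING line HOME/STATUS.md
2026-08-21T18:13:52Z (B).  File 2 = `BIJ88Decay223CkTorus` (the double sum at a source plaquette, the scale-`j` term, the multiscale sum,
(2.23) from [6I] Prop. 1.2 alone).  Decls used BY NAME (nothing restated): p08's `BIJ88Eq220Torus.DjE`/`CkE`/`CkE_apply`,
`BIJ85Ineq724Proof.Dk`/`column`/`abs_Dk_le`, `BIJ88Ineq217Ineq722Torus.ofLp_HkE_single`, `BIJ88Decay216Torus.sum_plaq_exp_neg_pdist_le`,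
`BIJ88Ineq217NearPart.pdist`; p09's `BIJ85Ineq723TorusCE.inner_toEj_single_left`/
`toEj_single`, `BIJ85Ineq724Torus.supDist_blk_le_distEU`, `BIJ85Ineq722Torus.torusRep`/`ctr`/`distEU`/`supDist_ctr_ctr`/
`supDist_ctr_blk_le`; p30's `BIJ85Eq611Torus.dOne`, `BIJ85Prop511Torus.lamE`; p11's `HkE`/`CE`; p21's `B6SectAOntoV1.blk_eq_iterBlockOf`;
p20's `B3TorusRadialSums`.

THE PRINTED TEXT (p. 262 [PDF 6], verbatim): *"By changing gauge in each term in the hierarchical sum defining 𝒟_k and applying (I.5.3.1),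
we obtain C_k = D_k + Σ_{j=0}^{k−1} D^{L^jη}_jC^{(j),L^jη}H^{*L^jη}_j∂*Q^{e*}_k∂. (2.22) The kernels of all these operators have an
exponential decay on their respective length scales; for D_k the required estimate is (I.7.2.4). The sum over j is not well controlled for
close points; this will not be important for us. For more distant points, however, the rapid decay of terms with small j controls the
scalings and the sum over j to yield a uniform bound |C_k(x,b′)| ≦ ce^{−c dist(x,b′)}, dist(x,b′) > c. (2.23) Here x ∈ T_η^{(k)},
b′ ∈ T₁^{(k)*}."*; [I] p. 326: *"λ(x) = (D_kB)(x), |D_k(x,b)| ≦ Me^{−δ dist(x,b)}. (7.2.4) This estimate follows from (5.1.4) and (7.2.2)."*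

THE TORUS DATA (all in the tree): tori `Balaban1983to89.Setup`/`Params` (`d ≥ 2`, block size `L`, standing range `k ≤ m + K`,
`η_k = L^{−k}`); fine sites `TSite P 0` (the η-lattice `T_η`), unit bonds `PBond P k` of `T₁^{(k)}` with `e_{b′} = toEj P k (Pi.single b′ 1)`,
unit plaquettes `TPlaq P k` with `e_p = toU P k (Pi.single p 1)`; `C_k = CkE P hd w c k` and `D_j = DjE P w c j = λ_j ∘ H_j` of (2.22)/(2.21)
(weights `w`, curl factor `c`; of record at `w = η_k^d`, `c = η_k⁻¹ = L^k`), `H_j = HkE`, `C^{(j)} = CE`, `∂* = adjoint (curlOp w c)`,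
`Q^{e*}_k = QesOp hd w k`, `∂₁ = dOne P k c` (unit-lattice curl, factor `c/L^k`); `u^{(j)}_p := H_j^*∂*Q^{e*}_ke_p` (the vector of the
(2.16) file, `BIJ88SigmaKernelDkTorus.adjoint_HkE_coord`); the (7.2.1) kernel `H_{j,μν}(x; y) = (torusRep P j (deltaAData …)).H (x,μ) (y,ν)`
of p09's torus carrier; distances `distEU P j x y = |x − ctr_j y|_∞/L^j` (fine site to unit site, unit of `T^{(j)}`), `supDist` (`ℓ^∞`
steps), `pdist` (`ℓ¹` on unit plaquettes).

WHAT IS PROVED (0 `sorry`, standard axioms; theorems only — proof lane):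
* §1 THE KERNEL THROUGH THE KERNELS OF THE FACTORS (any `w, c`): `DjE_single_apply` (**`D_j(x, b₁) = (D_je_{b₁})(x)` IS p08 g3's
  (I.7.2.4) kernel `Dk c j H_j x b₁`** for the (7.2.1) kernel of the Landau `H_j` of record, via `ofLp_HkE_single`), `dOne_single_apply`
  (`(∂₁e_{b′})(p) = curl (c/L^k) δ_{b′} p`), **`termCk_eq_sum`** (the scale-`j` term of `(C_ke_{b′})(x)` `= Σ_p (∂₁e_{b′})(p)·Σ_{b₁,b₂}
  D_j(x,b₁)·⟨e_{b₁}, C^{(j)}e_{b₂}⟩·u^{(j)}_p(b₂)`), **`CkE_single_apply`** (`C_k(x,b′) = D_k(x,b′) + Σ_{j<k}` scale-`j` terms).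
* §2 THE SOURCE `∂₁e_{b′}`: `supDist_le_one_of_curl_single_ne_zero` (`(∂e_{b′})(p) ≠ 0 ⇒ |p₋ − b′₋|_∞ ≤ 1`), `abs_curl_single_le`
  (`|(∂^{s}e_{b′})(p)| ≤ 4|s|`), **`sum_abs_curl_single_le`** (`Σ_p |(∂^{s}e_{b′})(p)| ≤ 4|s|·e^d·d²·4^d`, via p08's plaquette row sums).
* §3 THE `D_j` ENTRIES: `distEU_le_supDist_blk_add` (`|x − y| ≤ |x_j − y|_∞ + ½`), `lamFactor_le` (the `λ`-constant of `abs_Dk_le` at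
  `c = L^k`: `≤ d·L^j/L^k`), **`abs_DjE_single_le`** (`|D_j(x, b₁)| ≤ d(L^j/L^k)·Me^{δ}·e^{−δ|x − b₁₋|}` from the `|H|` member of (7.2.2)
  at scale `j` — [I] (7.2.4) *"from (5.1.4) and (7.2.2)"* for the `D_j` OF RECORD, the factor `L^j/L^k` being the length `L^{j−k}` of the
  axial-gauge contours of the `j`-blocks in the unit of `T^{(k)}`).
HONEST SCOPE.  (i) Entries and entrywise bounds only; the double sum, the multiscale sum and (2.23) are in file 2.  (ii) `U = 1`, real abelian fields,
torus (periodic b.c.), standing range; `d ≥ 2`.  (iii) Constants explicit, not optimal (`Σ_p|∂e_{b′}(p)|` is bounded through the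
exponential plaquette row sum rather than counted).  (iv) No `def`, no new named fact, nothing restated; NOT summit progress.  Unit
`lit-balaban-p08` (literature-prover-lit-balaban-p08-g8-0), 2026-08-21.
-/

open scoped BigOperators RealInnerProductSpace

namespace Literature.MathematicalPhysics.QuantumFieldTheory.BalabanImbrieJaffe1984to88.BIJ88Decay223CkKernel

open Balaban1983to89 hiding Site Plaq
open Balaban1983to89.LatticeFieldCalculus
open Balaban1983to89.B3TorusRadialSums (sum_exp_neg_supDist_le supDist_comm supDist_eq_zero_iff tdist_le_mul_supDist)
open B6SectAOntoV1 (blk_eq_iterBlockOf)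
open BIJ88SigmaKernelDkTorus BIJ88Ineq217Ineq722Torus BIJ88Ineq217NearPart BIJ88Decay216Torus
open BIJ85AxialPropagator411 BIJ85Prop521Torus BIJ85Sigma421Torus BIJ85Prop522Torus BIJ85Sigma422Eta BIJ85Prop511Torus
open BIJ85Eq611Torus (dOne)
open BIJ85Sect7Statements BIJ85Ineq722Torus BIJ85Eq721MinimizerKernel
open BIJ85Ineq722DeltaA (deltaAData)
open BIJ85Ineq724Proof (Dk column abs_Dk_le)
open BIJ85Ineq724Torus (supDist_blk_le_distEU)
open BIJ85GaugeFunction5113 (blk lamOf)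
open BIJ88Eq220Torus (DjE CkE DjE_apply CkE_apply)
open BIJ85Ineq723TorusCE (inner_toEj_single_left toEj_single)

open Balaban1983to89 renaming Site → TSite, Plaq → TPlaq

noncomputable section

variable {P : Params}

/-! ## §1  The kernel of `C_k` through the kernels of its factors -/

/-- the coordinates of the image of a linear map of Euclidean spaces through the coordinates of the argument:
`(Tv)_i = Σ_j v_j·(Te_j)_i`. [folklore] -/
private theorem apply_eq_sum_single {ι κ : Type*} [Fintype ι] [DecidableEq ι]
    (T : EuclideanSpace ℝ ι →ₗ[ℝ] EuclideanSpace ℝ κ) (v : EuclideanSpace ℝ ι) (i : κ) :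
    T v i = ∑ j, v j * T (EuclideanSpace.single j 1) i := by
  conv_lhs => rw [← (EuclideanSpace.basisFun ι ℝ).sum_repr v]
  rw [map_sum, WithLp.ofLp_sum, Finset.sum_apply]
  refine Finset.sum_congr rfl fun j _ => ?_
  rw [EuclideanSpace.basisFun_repr, EuclideanSpace.basisFun_apply, map_smul, WithLp.ofLp_smul, Pi.smul_apply,
    smul_eq_mul]

/-- `toU(δ_p) = e_p`. [folklore] -/
private theorem toU_single (k : ℕ) (p : TPlaq P k) (a : ℝ) : toU P k (Pi.single p a) = EuclideanSpace.single p a := rfl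

/-- **THE `D_j` ENTRIES ARE [I] (7.2.4)'s KERNEL**: `D_j(x, b₁) := (D_je_{b₁})(x) = λ_j(H_je_{b₁})(x)` ((2.21): `D_j = λ_j ∘ H_j`) IS
p08 g3's `Dk c j H_j x b₁` (*"λ(x) = (D_kB)(x)"*, `D_k(x,b) := λ(H_k(·;b))(x)`) for the (7.2.1) kernel `H_{j,μν}(x; y)` of the Landau
minimizer OF RECORD (`ofLp_HkE_single`: the column of p11's `HkE` at `e_{b₁}` is `H_{j,·ν}(·; y)`, `b₁ = ⟨y, ν⟩`); any `w > 0`, `c ≠ 0`,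
`a > 0`, `j ≤ m + K`. [cite: BalabanImbrieJaffe1985, (7.2.4) p.326] -/
theorem DjE_single_apply {j : ℕ} (hj : j ≤ P.m + P.K) {c : ℝ} (hc : c ≠ 0) {w : ℝ} (hw : 0 < w) {a : ℝ} (ha : 0 < a)
    (b₁ : PBond P j) (x : TSite P 0) :
    DjE P w c j (toEj P j (Pi.single b₁ 1)) x =
      Dk c j (fun μ ν z y => (torusRep P j (deltaAData hj a)).H (z, μ) (y, ν)) x b₁ := by
  rw [DjE_apply, lamE_apply]
  show lamOf c j (WithLp.ofLp (HkE P w c j (toEj P j (Pi.single b₁ 1)))) x = _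
  unfold Dk
  congr 1
  funext b''
  rw [column]
  exact ofLp_HkE_single hj hc hw ha b₁ b''.src b''.dir

/-- the source entries: `(∂₁e_{b′})(p) = (∂^{c/L^k}δ_{b′})(p)` (p30's unit-lattice curl `dOne P k c`, factor `c/L^k`; `= 1` at the
normalisation of record `c = L^k`). [cite: BalabanImbrieJaffe1988, (2.22) p.262] -/
theorem dOne_single_apply (k : ℕ) (c : ℝ) (b' : PBond P k) (p : TPlaq P k) :
    dOne P k c (toEj P k (Pi.single b' 1)) p = curl (c / (P.L : ℝ) ^ k) (Pi.single b' (1 : ℝ)) p := rfl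

/-- **THE SCALE-`j` TERM OF THE KERNEL OF `C_k` THROUGH THE KERNELS OF `D_j`, `C^{(j)}` AND `∂H_j`**: for every fine site `x` and unit
bond `b′ ∈ T₁^{(k)}`, `(D_jC^{(j)}H_j^*∂*Q^{e*}_k∂₁e_{b′})(x) = Σ_p (∂₁e_{b′})(p)·Σ_{b₁,b₂∈T^{(j)}} D_j(x,b₁)·⟨e_{b₁}, C^{(j)}e_{b₂}⟩·u^{(j)}_p(b₂)`
with `u^{(j)}_p = H_j^*∂*Q^{e*}_ke_p` the vector of the (2.16) file (`BIJ88SigmaKernelDkTorus.adjoint_HkE_coord`) — linearity through the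
plaquette coordinates of the source and the bond coordinates of `T^{(j)}` (any `w, c`). [cite: BalabanImbrieJaffe1988, (2.22) p.262] -/
theorem termCk_eq_sum (hd : 2 ≤ P.d) (w c : ℝ) (j k : ℕ) (x : TSite P 0) (b' : PBond P k) :
    DjE P w c j (CE P w c j (LinearMap.adjoint (HkE P w c j)
      (LinearMap.adjoint (curlOp (P := P) w c) (QesOp (P := P) hd w k (dOne P k c (toEj P k (Pi.single b' 1))))))) x =
      ∑ p : TPlaq P k, dOne P k c (toEj P k (Pi.single b' 1)) p *
        ∑ b₁ : PBond P j, ∑ b₂ : PBond P j, DjE P w c j (toEj P j (Pi.single b₁ 1)) x *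
          ⟪toEj P j (Pi.single b₁ 1), CE P w c j (toEj P j (Pi.single b₂ 1))⟫ *
          LinearMap.adjoint (HkE P w c j)
            (LinearMap.adjoint (curlOp (P := P) w c) (QesOp (P := P) hd w k (toU P k (Pi.single p 1)))) b₂ := by
  classical
  -- expand the source in plaquette coordinates
  set S : UnitPlaqSpace P k →ₗ[ℝ] EuclideanSpace ℝ (TSite P 0) :=
    DjE P w c j ∘ₗ CE P w c j ∘ₗ LinearMap.adjoint (HkE P w c j) ∘ₗ LinearMap.adjoint (curlOp (P := P) w c) ∘ₗ
      QesOp (P := P) hd w k with hS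
  have h1 := apply_eq_sum_single S (dOne P k c (toEj P k (Pi.single b' 1))) x
  simp only [hS, LinearMap.coe_comp, Function.comp_apply] at h1
  rw [h1]
  refine Finset.sum_congr rfl fun p _ => ?_
  rw [← toU_single]
  congr 1
  -- the vector `u_p`
  set u := LinearMap.adjoint (HkE P w c j)
    (LinearMap.adjoint (curlOp (P := P) w c) (QesOp (P := P) hd w k (toU P k (Pi.single p 1)))) with hu
  -- expand `u` in bond coordinates through `DjE ∘ CE`
  have h2 := apply_eq_sum_single (DjE P w c j ∘ₗ CE P w c j) u x
  simp only [LinearMap.coe_comp, Function.comp_apply] at h2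
  rw [h2]
  -- expand `CE e_{b₂}` in bond coordinates through `DjE`
  have h3 : ∀ b₂ : PBond P j, DjE P w c j (CE P w c j (EuclideanSpace.single b₂ 1)) x =
      ∑ b₁ : PBond P j, ⟪toEj P j (Pi.single b₁ 1), CE P w c j (toEj P j (Pi.single b₂ 1))⟫ *
        DjE P w c j (toEj P j (Pi.single b₁ 1)) x := by
    intro b₂
    rw [apply_eq_sum_single (DjE P w c j) _ x]
    refine Finset.sum_congr rfl fun b₁ _ => ?_
    rw [inner_toEj_single_left, toEj_single, toEj_single]
  simp only [h3, Finset.mul_sum]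
  rw [Finset.sum_comm]
  refine Finset.sum_congr rfl fun b₁ _ => Finset.sum_congr rfl fun b₂ _ => ?_
  ring

/-- **THE KERNEL OF `C_k`**: `C_k(x, b′) := (C_ke_{b′})(x) = D_k(x, b′) + Σ_{j<k} (D_jC^{(j)}H_j^*∂*Q^{e*}_k∂₁e_{b′})(x)` — (2.22) verbatim
(`BIJ88Eq220Torus.CkE_apply`) read entrywise (any `w, c`). [cite: BalabanImbrieJaffe1988, (2.22) p.262] -/
theorem CkE_single_apply (hd : 2 ≤ P.d) (w c : ℝ) (k : ℕ) (x : TSite P 0) (b' : PBond P k) :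
    CkE P hd w c k (toEj P k (Pi.single b' 1)) x = DjE P w c k (toEj P k (Pi.single b' 1)) x +
      ∑ j ∈ Finset.range k, DjE P w c j (CE P w c j (LinearMap.adjoint (HkE P w c j)
        (LinearMap.adjoint (curlOp (P := P) w c) (QesOp (P := P) hd w k (dOne P k c (toEj P k (Pi.single b' 1))))))) x := by
  rw [CkE_apply, WithLp.ofLp_add, Pi.add_apply, WithLp.ofLp_sum, Finset.sum_apply]

/-! ## §2  The source `∂₁e_{b′}`: a local, `ℓ¹`-small plaquette field -/

/-- `|x − (x + e_μ)|_∞ ≤ 1`. [folklore] -/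
private theorem supDist_shift_le {j : ℕ} (x : TSite P j) (μ : Fin P.d) : supDist x (x.shift μ) ≤ 1 := by
  have h := supDist_runSite_le x μ 1
  have h2 : runSite x μ 1 = x.shift μ := by
    show Function.update x μ (x μ + ((1 : ℕ) : ZMod _)) = Function.update x μ (x μ + 1)
    rw [Nat.cast_one]
  rwa [h2] at h

/-- **the curl of the unit bond field `δ_{b′}` vanishes at the plaquettes not adjacent to `b′`**: `(∂^{s}δ_{b′})(p) ≠ 0 ⇒ |p₋ − b′₋|_∞ ≤ 1`
(the four bonds of `p = (x; μ < ν)` start at `x`, `x + e_μ`, `x + e_ν`). [cite: BalabanImbrieJaffe1988, (2.23) p.262] -/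
theorem supDist_le_one_of_curl_single_ne_zero {k : ℕ} (s : ℝ) (b' : PBond P k) (p : TPlaq P k)
    (h : curl s (Pi.single b' (1 : ℝ)) p ≠ 0) : supDist p.src b'.src ≤ 1 := by
  classical
  by_contra hne
  apply h
  have h0 : ∀ e : PBond P k, supDist p.src e.src ≤ 1 → (Pi.single b' (1 : ℝ) : PBond P k → ℝ) e = 0 := by
    intro e he
    rw [Pi.single_eq_of_ne]
    rintro rfl
    exact hne he
  have hs : supDist p.src p.src ≤ 1 := by rw [(supDist_eq_zero_iff _ _).2 rfl]; exact zero_le_one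
  simp only [curl]
  rw [h0 ⟨p.src, p.μ⟩ hs, h0 ⟨p.src.shift p.μ, p.ν⟩ (supDist_shift_le p.src p.μ),
    h0 ⟨p.src.shift p.ν, p.μ⟩ (supDist_shift_le p.src p.ν), h0 ⟨p.src, p.ν⟩ hs]
  simp

/-- `|(∂^{s}δ_{b′})(p)| ≤ 4|s|` (four bonds, each coordinate of `δ_{b′}` at most `1`). [cite: BalabanImbrieJaffe1988, (2.23) p.262] -/
theorem abs_curl_single_le {k : ℕ} (s : ℝ) (b' : PBond P k) (p : TPlaq P k) :
    |curl s (Pi.single b' (1 : ℝ)) p| ≤ 4 * |s| := by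
  classical
  have h1 : ∀ e : PBond P k, |(Pi.single b' (1 : ℝ) : PBond P k → ℝ) e| ≤ 1 := by
    intro e
    rw [Pi.single_apply]
    split_ifs <;> simp
  simp only [curl, smul_eq_mul, abs_mul]
  have h := abs_add_le ((Pi.single b' (1 : ℝ) : PBond P k → ℝ) ⟨p.src, p.μ⟩ + (Pi.single b' (1 : ℝ) : PBond P k → ℝ) ⟨p.src.shift p.μ, p.ν⟩
    - (Pi.single b' (1 : ℝ) : PBond P k → ℝ) ⟨p.src.shift p.ν, p.μ⟩) (-(Pi.single b' (1 : ℝ) : PBond P k → ℝ) ⟨p.src, p.ν⟩)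
  have h2 := h1 ⟨p.src, p.μ⟩
  have h3 := h1 ⟨p.src.shift p.μ, p.ν⟩
  have h4 := h1 ⟨p.src.shift p.ν, p.μ⟩
  have h5 := h1 ⟨p.src, p.ν⟩
  rw [mul_comm]
  refine mul_le_mul_of_nonneg_right ?_ (abs_nonneg s)
  calc _ ≤ |(Pi.single b' (1 : ℝ) : PBond P k → ℝ) ⟨p.src, p.μ⟩| + |(Pi.single b' (1 : ℝ) : PBond P k → ℝ) ⟨p.src.shift p.μ, p.ν⟩|
        + |(Pi.single b' (1 : ℝ) : PBond P k → ℝ) ⟨p.src.shift p.ν, p.μ⟩| + |(Pi.single b' (1 : ℝ) : PBond P k → ℝ) ⟨p.src, p.ν⟩| := by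
        refine (abs_sub _ _).trans (add_le_add ((abs_sub _ _).trans (add_le_add (abs_add_le _ _) le_rfl)) le_rfl)
    _ ≤ 1 + 1 + 1 + 1 := by linarith
    _ = 4 := by norm_num

/-- **the source is `ℓ¹`-small uniformly in the volume and in `k`**: `Σ_{p∈T₁^{(k)}} |(∂^{s}δ_{b′})(p)| ≤ 4|s|·e^d·d²(2(1+1))^d` — the
nonzero terms sit at `ℓ¹`-distance `≤ d` from a plaquette `p₀` at `b′₋` (`d ≥ 2`), so `𝟙 ≤ e^{d}e^{−pdist(p₀,p)}` and p08's plaquette row sum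
`sum_plaq_exp_neg_pdist_le` (rate `1`) bounds the count. [cite: BalabanImbrieJaffe1988, (2.23) p.262] -/
theorem sum_abs_curl_single_le (hd : 2 ≤ P.d) {k : ℕ} (s : ℝ) (b' : PBond P k) :
    ∑ p : TPlaq P k, |curl s (Pi.single b' (1 : ℝ)) p| ≤ 4 * |s| * (Real.exp P.d * ((P.d : ℝ) ^ 2 * (2 * (1 + (1:ℝ)⁻¹)) ^ P.d)) := by
  -- a plaquette at `b′₋`
  set p₀ : TPlaq P k := ⟨b'.src, ⟨0, by omega⟩, ⟨1, by omega⟩, by simp [Fin.lt_def]⟩ with hp₀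
  have hpt : ∀ p : TPlaq P k, |curl s (Pi.single b' (1 : ℝ)) p| ≤ 4 * |s| * (Real.exp P.d * Real.exp (-1 * pdist p₀ p)) := by
    intro p
    by_cases h : curl s (Pi.single b' (1 : ℝ)) p = 0
    · rw [h, abs_zero]; positivity
    · have h1 := supDist_le_one_of_curl_single_ne_zero s b' p h
      have h2 : pdist p₀ p ≤ P.d := by
        unfold pdist
        have h3 := tdist_le_mul_supDist b'.src p.src
        rw [supDist_comm] at h1
        have h4 : Balaban1983to89.Site.tdist b'.src p.src ≤ P.d := h3.trans (by nlinarith)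
        exact_mod_cast h4
      have h5 : (1 : ℝ) ≤ Real.exp P.d * Real.exp (-1 * pdist p₀ p) := by
        rw [← Real.exp_add]
        exact Real.one_le_exp (by linarith)
      calc |curl s (Pi.single b' (1 : ℝ)) p| ≤ 4 * |s| * 1 := by rw [mul_one]; exact abs_curl_single_le s b' p
        _ ≤ _ := mul_le_mul_of_nonneg_left h5 (by positivity)
  calc _ ≤ ∑ p : TPlaq P k, 4 * |s| * (Real.exp P.d * Real.exp (-1 * pdist p₀ p)) := Finset.sum_le_sum fun p _ => hpt p
    _ = 4 * |s| * (Real.exp P.d * ∑ p : TPlaq P k, Real.exp (-1 * pdist p₀ p)) := by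
        rw [← Finset.mul_sum, ← Finset.mul_sum]
    _ ≤ _ := by
        refine mul_le_mul_of_nonneg_left (mul_le_mul_of_nonneg_left ?_ (Real.exp_pos _).le) (by positivity)
        exact sum_plaq_exp_neg_pdist_le one_pos p₀

/-! ## §3  The `D_j` entries: [I] (7.2.4) for the `D_j` of record -/

/-- **the fine-site distance is within `½` of the block distance**: `|x − y| ≤ |x_j − y|_∞ + ½` (`x_j = blk j x` the `j`-block of `x`;
`|x − ctr_j(x_j)|_∞ ≤ (L^j − 1)/2`, `|ctr_j y − ctr_j y′|_∞ = L^j|y − y′|_∞`) — companion of p09's `supDist_blk_le_distEU`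
(`|x_j − y|_∞ ≤ |x − y| + ½`). [cite: BalabanImbrieJaffe1985, (7.2.2) p.325] -/
theorem distEU_le_supDist_blk_add {j : ℕ} (hj : j ≤ P.m + P.K) (x : TSite P 0) (y : TSite P j) :
    distEU P j x y ≤ (supDist (blk j x) y : ℝ) + 1 / 2 := by
  have hL := pow_pos P.cast_L_pos j
  unfold distEU
  rw [div_le_iff₀ hL]
  have h1 := supDist_triangle x (ctr j (blk j x)) (ctr j y)
  have h2 : supDist x (ctr j (blk j x)) ≤ (P.L ^ j - 1) / 2 := by
    rw [blk_eq_iterBlockOf]; exact supDist_ctr_blk_le hj x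
  have h3 := supDist_ctr_ctr hj (blk j x) y
  have h4 : (((P.L ^ j - 1) / 2 : ℕ) : ℝ) ≤ (P.L : ℝ) ^ j / 2 := by
    have h5 : (((P.L ^ j - 1) / 2 : ℕ) : ℝ) * 2 ≤ (P.L : ℝ) ^ j := by
      have h6 : ((P.L ^ j - 1) / 2) * 2 ≤ P.L ^ j := (Nat.div_mul_le_self _ _).trans (Nat.sub_le _ _)
      exact_mod_cast h6
    linarith
  have h7 : (supDist x (ctr j y) : ℝ) ≤ (((P.L ^ j - 1) / 2 : ℕ) : ℝ) + (P.L : ℝ) ^ j * (supDist (blk j x) y : ℝ) := by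
    have := h1.trans (Nat.add_le_add h2 (le_of_eq h3))
    exact_mod_cast this
  nlinarith

/-- `0 < L^n` in `ℝ`. [folklore] -/
private theorem cast_pow_L_pos' (n : ℕ) : (0 : ℝ) < (P.L : ℝ) ^ n := pow_pos P.cast_L_pos n

/-- **the constant of p08 g3's `abs_Dk_le` at the curl factor of record `c = L^k`**: `2·(d(L−1)/2)·(Σ_{i<j}L^i)/L^k ≤ d·L^j/L^k` — the
axial-gauge contour of a `j`-block has `≤ d(L^j − 1)` η-bonds of length `η_k = L^{−k}`: the `λ_j` of the `j`-blocks is SHORT in the unit of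
`T^{(k)}` (`(Σ_{i<j}L^i)(L − 1) = L^j − 1`, `geom_sum_mul`). [cite: BalabanImbrieJaffe1985, (5.1.13) p.315] -/
theorem lamFactor_le (j k : ℕ) :
    2 * ((P.d * ((P.L - 1) / 2) : ℕ) : ℝ) * (∑ i ∈ Finset.range j, (P.L : ℝ) ^ i) / |(P.L : ℝ) ^ k| ≤
      (P.d : ℝ) * ((P.L : ℝ) ^ j / (P.L : ℝ) ^ k) := by
  have hLk := cast_pow_L_pos' (P := P) k
  have hL1 : (1 : ℝ) < P.L := by exact_mod_cast P.hL.2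
  rw [abs_of_pos hLk, mul_div_assoc', div_le_div_iff_of_pos_right hLk]
  have h1 : 2 * ((P.d * ((P.L - 1) / 2) : ℕ) : ℝ) ≤ (P.d : ℝ) * ((P.L : ℝ) - 1) := by
    have h2 : 2 * (P.d * ((P.L - 1) / 2)) ≤ P.d * (P.L - 1) := by
      have := Nat.div_mul_le_self (P.L - 1) 2
      nlinarith
    have h3 : ((P.L - 1 : ℕ) : ℝ) = (P.L : ℝ) - 1 := by
      rw [Nat.cast_sub (le_of_lt P.hL.2)]; simp
    have h4 : (2 : ℝ) * ((P.d * ((P.L - 1) / 2) : ℕ) : ℝ) ≤ (P.d : ℝ) * ((P.L - 1 : ℕ) : ℝ) := by exact_mod_cast h2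
    rw [h3] at h4
    exact h4
  have hgeom : (∑ i ∈ Finset.range j, (P.L : ℝ) ^ i) * ((P.L : ℝ) - 1) = (P.L : ℝ) ^ j - 1 := geom_sum_mul _ _
  have hS : 0 ≤ ∑ i ∈ Finset.range j, (P.L : ℝ) ^ i := Finset.sum_nonneg fun i _ => (cast_pow_L_pos' i).le
  calc 2 * ((P.d * ((P.L - 1) / 2) : ℕ) : ℝ) * ∑ i ∈ Finset.range j, (P.L : ℝ) ^ i
      ≤ (P.d : ℝ) * ((P.L : ℝ) - 1) * ∑ i ∈ Finset.range j, (P.L : ℝ) ^ i := mul_le_mul_of_nonneg_right h1 hS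
    _ = (P.d : ℝ) * ((P.L : ℝ) ^ j - 1) := by rw [mul_assoc, mul_comm ((P.L : ℝ) - 1), hgeom]
    _ ≤ (P.d : ℝ) * (P.L : ℝ) ^ j := by nlinarith [P.hd]

/-- **[I] (7.2.4) FOR THE `D_j` OF RECORD ON THE TORI, from the `|H|` member of (7.2.2)**: if `|H_{j,μν}(x″; y)| ≤ Me^{−δ|x″ − y|}`
for all `μ, ν, x″, y` (`|x″ − y| = distEU`, the fine-site distance in the unit of `T^{(j)}`; `M, δ ≥ 0`), then for every fine site `x`
and unit bond `b₁ ∈ T^{(j)}`, `|D_j(x, b₁)| ≤ d(L^j/L^k)·Me^{δ}·e^{−δ|x − b₁₋|}` at the curl factor `c = L^k` (any `w > 0`) — p08 g3's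
mechanism `abs_Dk_le` (*"λ(·)(x) reads its argument only on the η-bonds of the block of x, where |H| ≤ Me^{−δρ(x_j, b₋)}, and λ is
bounded"*) with `ρ = |·|_∞` on `T^{(j)}`, the two half-steps between the fine-site and the block distances (`supDist_blk_le_distEU`,
`distEU_le_supDist_blk_add`) costing `e^{δ/2}` each, and `lamFactor_le`. [cite: BalabanImbrieJaffe1985, (7.2.4) p.326] -/
theorem abs_DjE_single_le {k j : ℕ} (hj : j ≤ P.m + P.K) {w : ℝ} (hw : 0 < w) {a : ℝ} (ha : 0 < a) {δ M : ℝ}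
    (hδ : 0 ≤ δ) (hM : 0 ≤ M)
    (hH : ∀ (μ ν : Fin P.d) (x'' : TSite P 0) (y : TSite P j),
      |(torusRep P j (deltaAData hj a)).H (x'', μ) (y, ν)| ≤ M * Real.exp (-(δ * distEU P j x'' y)))
    (x : TSite P 0) (b₁ : PBond P j) :
    |DjE P w ((P.L : ℝ) ^ k) j (toEj P j (Pi.single b₁ 1)) x| ≤
      (P.d : ℝ) * ((P.L : ℝ) ^ j / (P.L : ℝ) ^ k) * (M * Real.exp δ) * Real.exp (-(δ * distEU P j x b₁.src)) := by
  have hLk : (P.L : ℝ) ^ k ≠ 0 := (cast_pow_L_pos' k).ne'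
  rw [DjE_single_apply hj hLk hw ha]
  -- the `|H|` member measured from the block
  have hH' : ∀ (μ ν : Fin P.d) (x'' : TSite P 0) (y : TSite P j),
      |(torusRep P j (deltaAData hj a)).H (x'', μ) (y, ν)| ≤
        M * Real.exp (δ / 2) * Real.exp (-(δ * (supDist (blk j x'') y : ℝ))) := by
    intro μ ν x'' y
    refine (hH μ ν x'' y).trans ?_
    rw [mul_assoc, ← Real.exp_add]
    refine mul_le_mul_of_nonneg_left (Real.exp_le_exp.2 ?_) hM
    have h := supDist_blk_le_distEU hj x'' y
    nlinarith
  have h := abs_Dk_le hj ((P.L : ℝ) ^ k) (fun μ ν z y => (torusRep P j (deltaAData hj a)).H (z, μ) (y, ν))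
    (fun z y => (supDist z y : ℝ)) (by positivity) hH' x b₁
  refine h.trans ?_
  have h2 : M * Real.exp (δ / 2) * Real.exp (-(δ * (supDist (blk j x) b₁.src : ℝ))) ≤
      M * Real.exp δ * Real.exp (-(δ * distEU P j x b₁.src)) := by
    rw [mul_assoc, mul_assoc, ← Real.exp_add, ← Real.exp_add]
    refine mul_le_mul_of_nonneg_left (Real.exp_le_exp.2 ?_) hM
    have h3 := distEU_le_supDist_blk_add hj x b₁.src
    nlinarith
  have hΛ : 0 ≤ 2 * ((P.d * ((P.L - 1) / 2) : ℕ) : ℝ) * (∑ i ∈ Finset.range j, (P.L : ℝ) ^ i) / |(P.L : ℝ) ^ k| := by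
    positivity
  calc _ ≤ 2 * ((P.d * ((P.L - 1) / 2) : ℕ) : ℝ) * (∑ i ∈ Finset.range j, (P.L : ℝ) ^ i) / |(P.L : ℝ) ^ k| *
        (M * Real.exp δ * Real.exp (-(δ * distEU P j x b₁.src))) := mul_le_mul_of_nonneg_left h2 hΛ
    _ ≤ (P.d : ℝ) * ((P.L : ℝ) ^ j / (P.L : ℝ) ^ k) * (M * Real.exp δ * Real.exp (-(δ * distEU P j x b₁.src))) :=
        mul_le_mul_of_nonneg_right (lamFactor_le j k) (by positivity)
    _ = _ := by ring

end

end Literature.MathematicalPhysics.QuantumFieldTheory.BalabanImbrieJaffe1984to88.BIJ88Decay223CkKernel
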